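import Summits.BirchSwinnertonDyer.Rank1Residual.Additive.GordTorsionAnomalous
import Summits.BirchSwinnertonDyer.BirchSwinnertonDyer.Theorems.EdixhovenFibreFiveSevenTwistDegreeStepFiveSevenAddvUnitTwist
import HarnessLib

/-!
# A quadratic twist by a `p`-adic unit NON-RESIDUE kills the `ℚ_p`-rational `p`-torsion of an additive
# curve at `p ∈ {5, 7}` — the PER-CURVE form of the TORS-TWIST input of TDS57
# (route `EdixhovenFibreFiveSeven`, crux TDS57 stmt-BirchSwinnertonDyer-22227, `--supports`, helper)

Cell `pub/bsd-wall` (D-0145 line `route-BirchSwinnertonDyer-EdixhovenFibreFiveSeven`), seat `bsd-line-edix-p3`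
(prover). THEOREMS ONLY (no definition, no named fact, no `sorry`); route-free. Nothing is closed and BSD is
not proved by this file.

## What and why

The sibling theorem `TwistDegreeStepFiveSevenKP.twistDegreeStepFiveSeven_of_kato_of_twistInputs` (p584905/
p585596) proves TDS57 by name from F″ and two spelled-out inputs, (L-TWIST) and (TORS-TWIST); the latter says:
`E[p]` irreducible, `(q*/p) = −1`, a `ℚ_p`-rational point of order `p` SOMEWHERE in the class of `V₀` ⟹ NONE
anywhere in the class of `V₀ ⊗ χ_{q*}`. Its natural proof (`E[p] ⊗ χ` vs `E[p]` as `G_{ℚ_p}`-modules) needs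
transport of `ℚ_p`-rational torsion along `ℚ`-isogenies, which the tree's `Isogeny` (a map on `ℚ̄`-points) does
not supply. The PER-CURVE statement, however, is elementary once the Kosters–Pannekoek exception is read as a
RESIDUE CLASS — which the tree already does (`Rank1Residual/Additive/GordTorsionAnomalous`,
`exists_residue_of_prime_zsmul_eq_zero_of_addv`: a `ℚ_p`-point of order `p` on a globally minimal additive
`W` at `p ≥ 5` forces `p = 5 ∧ c₄(W) = −5n, n ≡ 1 (mod 5)` or `p = 7 ∧ c₆(W) = −7n, n ≡ −1 (mod 7)`):

* `false_of_residue_twist_rel` — pure arithmetic: integers `n ≡ n' ≢ 0 (mod p)`, `d` with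
  `d^{(p−1)/2} ≡ −1 (mod p)`, and a rational `r` with `n' = r^{p−1} d^{(p−1)/2} n` cannot coexist (`r` is then
  a `p`-adic unit, `r^{p−1} ≡ 1`);
* **`eq_zero_of_prime_nsmul_eq_zero_of_unitTwist`** — for `W/ℚ` globally minimal, additive at `p ∈ {5, 7}`,
  with a `ℚ_p`-rational point of order `p`, an integer `d` that is a NON-SQUARE mod `p`, and any globally
  minimal model `Vχ = v • W^{(d)}` of the twist: **`Vχ(ℚ_p)` has no point of order `p`**
  (`c₄(Vχ) = u⁻⁴d²c₄(W)`, `c₆(Vχ) = u⁻⁶d³c₆(W)`, `u = v.u ∈ ℚˣ`; additivity of `Vχ` at `p` is the landed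
  `AddvUnitTwist.addv_of_model_unit_twist`);
* `eq_zero_of_prime_nsmul_eq_zero_of_twist_auxPrime` — the instance `d = q* = (−1)^{(q−1)/2} q` for a prime
  `q ≠ p` with `q*` a non-square mod `p` (the auxiliary prime of `TwistDegreeStepFiveSevenKP.exists_auxPrime`).

With this, the KP sub-residue argument can be run by a case split on the `p`-torsion of the OPTIMAL curve only
(sibling file `…TwistDegreeStepFiveSevenPeriodTwist`), and the class-wide TORS-TWIST hypothesis disappears.

References: [KostersPannekoek2017] Thm. 1, Cor. 2; Kim–Nakamura, J. Number Theory 2020 (arXiv:1808.07726)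
§2.3 Assumption 2.5; [Mazur1977] Ch. III §5, Step 1, p. 158; [SilvermanAEC2009] III.1 Table 3.1, X.5 Cor. 5.4.
-/

set_option autoImplicit false
-- the Theorems directory repeats the summit name (sibling precedent `SignedBaseChangeAssembly.lean`)
set_option linter.dupNamespace false

noncomputable section

open scoped Classical

open WeierstrassCurve Literature.NumberTheory.EllipticCurves
  Literature.NumberTheory.EllipticCurves.Rank1Residual
  Summit.BirchSwinnertonDyer.Rank1Residual Summit.BirchSwinnertonDyer.Rank1Residual.Additive

namespace Summit.BirchSwinnertonDyer.BirchSwinnertonDyer.Theorems.UnitTwistTorsion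

/-! ### §1 Arithmetic: `n' = r^{p−1} d^{(p−1)/2} n` is impossible for units `n ≡ n'`, `(d/p) = −1` -/

/-- **The residue obstruction.** Let `p > 2` be prime, `s ∈ 𝔽_pˣ`, `n, n' ∈ ℤ` with `n ≡ n' ≡ s (mod p)`,
`d ∈ ℤ` with `d^{⌊p/2⌋} ≡ −1 (mod p)` (Euler: `d` a unit non-residue), and `r ∈ ℚ` with
`n' = r^{p−1} · d^{⌊p/2⌋} · n`. Then `False`: writing `r = a/b` in lowest terms, `n' b^{p−1} = a^{p−1} d^{⌊p/2⌋} n`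
in `ℤ`; reducing mod `p`, `p ∤ ab` (else `p` divides both), so `a^{p−1} ≡ b^{p−1} ≡ 1` and `s = −s`, `s = 0`.
[folklore] -/
theorem false_of_residue_twist_rel {p : ℕ} [hp : Fact p.Prime] (hp2 : 2 < p) {s : ZMod p} (hs : s ≠ 0)
    {n n' d : ℤ} (hn : (n : ZMod p) = s) (hn' : (n' : ZMod p) = s)
    (hd : (d : ZMod p) ^ (p / 2) = -1) {r : ℚ}
    (h : (n' : ℚ) = r ^ (p - 1) * (d : ℚ) ^ (p / 2) * n) : False := by
  haveI : Fact (2 < p) := ⟨hp2⟩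
  have hp1 : p - 1 ≠ 0 := by omega
  -- clear denominators: `n' · den^{p-1} = num^{p-1} · d^{p/2} · n`
  have hden : (r.den : ℚ) ≠ 0 := by exact_mod_cast r.den_nz
  have hnum : (r.num : ℚ) = r * r.den := (div_eq_iff hden).mp (Rat.num_div_den r)
  have h2 : (n' : ℚ) * (r.den : ℚ) ^ (p - 1) = (r.num : ℚ) ^ (p - 1) * (d : ℚ) ^ (p / 2) * n := by
    rw [hnum, mul_pow, h]; ring
  have h3 : n' * (r.den : ℤ) ^ (p - 1) = r.num ^ (p - 1) * d ^ (p / 2) * n := by exact_mod_cast h2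
  have h4 : (n' : ZMod p) * ((r.den : ℕ) : ZMod p) ^ (p - 1) =
      (r.num : ZMod p) ^ (p - 1) * (d : ZMod p) ^ (p / 2) * (n : ZMod p) := by
    have := congrArg (Int.cast : ℤ → ZMod p) h3
    push_cast at this
    exact this
  rw [hn, hn', hd] at h4
  -- `p ∤ num`, `p ∤ den`
  by_cases hnum0 : (r.num : ZMod p) = 0
  · rw [hnum0, zero_pow hp1, zero_mul, zero_mul, mul_eq_zero] at h4
    rcases h4 with h4 | h4
    · exact hs h4
    · have hden0 : ((r.den : ℕ) : ZMod p) = 0 := (pow_eq_zero_iff hp1).mp h4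
      have h5num : p ∣ r.num.natAbs := by
        have := Int.natAbs_dvd_natAbs.mpr ((ZMod.intCast_zmod_eq_zero_iff_dvd _ _).mp hnum0)
        simpa using this
      have h5den : p ∣ r.den := (ZMod.natCast_eq_zero_iff _ _).mp hden0
      have hcop := Nat.Coprime.coprime_dvd_left h5num (Nat.Coprime.coprime_dvd_right h5den r.reduced)
      exact hp.out.ne_one ((Nat.coprime_self p).mp hcop)
  by_cases hden0 : ((r.den : ℕ) : ZMod p) = 0
  · rw [hden0, zero_pow hp1, mul_zero, ZMod.pow_card_sub_one_eq_one hnum0, one_mul, zero_eq_mul] at h4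
    rcases h4 with h4 | h4
    · exact (ZMod.neg_one_ne_one (n := p)) (by linear_combination 2 * h4)
    · exact hs h4
  rw [ZMod.pow_card_sub_one_eq_one hnum0, ZMod.pow_card_sub_one_eq_one hden0, mul_one, one_mul,
    neg_one_mul, eq_neg_iff_add_eq_zero, ← two_mul, mul_eq_zero] at h4
  rcases h4 with h4 | h4
  · exact (ZMod.neg_one_ne_one (n := p)) (by linear_combination -h4)
  · exact hs h4

/-! ### §2 The unit non-residue twist kills the `ℚ_p`-rational `p`-torsion (`p ∈ {5, 7}`) -/

section Twist

variable {p : ℕ} [hp : Fact p.Prime]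

/-- Euler's criterion for an integer that is a NON-square mod `p`: `d ≢ 0` and `d^{⌊p/2⌋} ≡ −1 (mod p)`.
[folklore] -/
theorem pow_div_two_eq_neg_one_of_not_isSquare {d : ℤ} (hd : ¬ IsSquare ((d : ℤ) : ZMod p)) :
    (d : ZMod p) ≠ 0 ∧ (d : ZMod p) ^ (p / 2) = -1 := by
  have h0 : (d : ZMod p) ≠ 0 := fun h ↦ hd (by rw [h]; exact IsSquare.zero)
  refine ⟨h0, ?_⟩
  rcases ZMod.pow_div_two_eq_neg_one_or_one p h0 with h | h
  · exact absurd ((ZMod.euler_criterion p h0).mpr h) hd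
  · exact h

/-- **A quadratic twist by a unit non-residue kills the `ℚ_p`-rational `p`-torsion, `p ∈ {5, 7}`.** Let `W/ℚ`
be globally minimal and additive at `p ∈ {5, 7}` with a `ℚ_p`-rational point `P ≠ O`, `p • P = O`; let
`d ∈ ℤ` be a NON-square mod `p`, and `Vχ = v • W^{(d)}` any globally minimal model of the quadratic twist.
Then `Vχ(ℚ_p)` has no point of order `p`. Indeed both curves are additive at `p`
(`AddvUnitTwist.addv_of_model_unit_twist`), so a `p`-torsion point on each would force (tree,
`exists_residue_of_prime_zsmul_eq_zero_of_addv`) `c₄ = −5n`, `n ≡ 1 (mod 5)` on both at `p = 5`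
(resp. `c₆ = −7n`, `n ≡ −1 (mod 7)` at `p = 7`), while `c₄(Vχ) = u⁻⁴d²c₄(W)`, `c₆(Vχ) = u⁻⁶d³c₆(W)` and
`d² ≡ −1 (mod 5)` (resp. `d³ ≡ −1 (mod 7)`) — `false_of_residue_twist_rel`.
[cite: KostersPannekoek2017, Thm. 1 and Cor. 2] [cite: SilvermanAEC2009, III.1 Table 3.1 and X.5 Cor. 5.4] -/
theorem eq_zero_of_prime_nsmul_eq_zero_of_unitTwist (hp57 : p = 5 ∨ p = 7)
    (W : WeierstrassCurve ℚ) [W.IsElliptic] [W.IsGloballyMinimal] (hadd : Addv W p)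
    {P : (W.baseChange ℚ_[p]).toAffine.Point} (hP0 : P ≠ 0) (hP : p • P = 0)
    {d : ℤ} (hd : ¬ IsSquare ((d : ℤ) : ZMod p))
    (Vχ : WeierstrassCurve ℚ) [Vχ.IsElliptic] [Vχ.IsGloballyMinimal] (v : VariableChange ℚ)
    (hv : v • W.quadraticTwist (d : ℚ) = Vχ)
    {Q : (Vχ.baseChange ℚ_[p]).toAffine.Point} (hQ : p • Q = 0) : Q = 0 := by
  have hp5 : 5 ≤ p := by rcases hp57 with rfl | rfl <;> norm_num
  have hp2 : p ≠ 2 := by omega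
  obtain ⟨hd0, hdpow⟩ := pow_div_two_eq_neg_one_of_not_isSquare hd
  have hpd : ¬ (p : ℤ) ∣ d := fun h ↦ hd0 ((ZMod.intCast_zmod_eq_zero_iff_dvd d p).mpr h)
  have hd0' : d ≠ 0 := fun h ↦ hpd (h ▸ dvd_zero _)
  have hdQ0 : (d : ℚ) ≠ 0 := by exact_mod_cast hd0'
  have hval : padicValRat p (d : ℚ) = 0 := by
    rw [padicValRat.of_int]
    exact_mod_cast padicValInt.eq_zero_of_not_dvd hpd
  -- additivity of the twisted model at `p`
  have haddχ : Addv Vχ p := AddvUnitTwist.addv_of_model_unit_twist hp2 hdQ0 hval hadd ⟨v, hv⟩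
  by_contra hQ0
  have hP' : (p : ℤ) • P = 0 := by rw [natCast_zsmul]; exact hP
  have hQ' : (p : ℤ) • Q = 0 := by rw [natCast_zsmul]; exact hQ
  have resW := exists_residue_of_prime_zsmul_eq_zero_of_addv W p hp5 hadd hP0 hP'
  have resV := exists_residue_of_prime_zsmul_eq_zero_of_addv Vχ p hp5 haddχ hQ0 hQ'
  -- `c₄(Vχ) = u⁻⁴ d² c₄(W)`, `c₆(Vχ) = u⁻⁶ d³ c₆(W)`
  have hc₄ : Vχ.c₄ = (↑v.u⁻¹ : ℚ) ^ 4 * ((d : ℚ) ^ 2 * W.c₄) := by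
    rw [← hv, variableChange_c₄, quadraticTwist_c₄]
  have hc₆ : Vχ.c₆ = (↑v.u⁻¹ : ℚ) ^ 6 * ((d : ℚ) ^ 3 * W.c₆) := by
    rw [← hv, variableChange_c₆, quadraticTwist_c₆]
  rcases hp57 with rfl | rfl
  · -- `p = 5`: `c₄ = −5n`, `n ≡ 1`
    rcases resW with ⟨-, n, -, hn1, hWn⟩ | ⟨h57, -⟩
    swap
    · norm_num at h57
    rcases resV with ⟨-, n', -, hn1', hVn⟩ | ⟨h57, -⟩
    swap
    · norm_num at h57
    have key : (n' : ℚ) = (↑v.u⁻¹ : ℚ) ^ (5 - 1) * (d : ℚ) ^ (5 / 2) * n := by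
      rw [show (5 : ℕ) - 1 = 4 from rfl, show (5 : ℕ) / 2 = 2 from rfl]
      have e := hVn
      rw [hc₄, hWn] at e
      linear_combination (1 / 5 : ℚ) * e
    refine false_of_residue_twist_rel (p := 5) (by norm_num) (s := 1) one_ne_zero ?_ ?_ hdpow key
    · simpa using (ZMod.intCast_eq_intCast_iff n 1 5).mpr hn1
    · simpa using (ZMod.intCast_eq_intCast_iff n' 1 5).mpr hn1'
  · -- `p = 7`: `c₆ = −7n`, `n ≡ −1`
    rcases resW with ⟨h57, -⟩ | ⟨-, n, -, hn1, hWn⟩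
    · norm_num at h57
    rcases resV with ⟨h57, -⟩ | ⟨-, n', -, hn1', hVn⟩
    · norm_num at h57
    have key : (n' : ℚ) = (↑v.u⁻¹ : ℚ) ^ (7 - 1) * (d : ℚ) ^ (7 / 2) * n := by
      rw [show (7 : ℕ) - 1 = 6 from rfl, show (7 : ℕ) / 2 = 3 from rfl]
      have e := hVn
      rw [hc₆, hWn] at e
      linear_combination (1 / 7 : ℚ) * e
    refine false_of_residue_twist_rel (p := 7) (by norm_num) (s := -1) (neg_ne_zero.mpr one_ne_zero) ?_ ?_ hdpow key
    · simpa using (ZMod.intCast_eq_intCast_iff n (-1) 7).mpr hn1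
    · simpa using (ZMod.intCast_eq_intCast_iff n' (-1) 7).mpr hn1'

/-- **The instance used by the repair: the auxiliary prime.** For a prime `q ≠ p` (`p ∈ {5, 7}`) with
`q* = (−1)^{(q−1)/2} q` a NON-square mod `p` (the prime of `TwistDegreeStepFiveSevenKP.exists_auxPrime`),
`W/ℚ` globally minimal and additive at `p` with a `ℚ_p`-rational point of order `p`, and any globally minimal
model `Vχ = v • W^{(q*)}`: `Vχ(ℚ_p)` has no point of order `p`. [cite: KostersPannekoek2017, Thm. 1 and Cor. 2] -/
theorem eq_zero_of_prime_nsmul_eq_zero_of_twist_auxPrime (hp57 : p = 5 ∨ p = 7)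
    (W : WeierstrassCurve ℚ) [W.IsElliptic] [W.IsGloballyMinimal] (hadd : Addv W p)
    {P : (W.baseChange ℚ_[p]).toAffine.Point} (hP0 : P ≠ 0) (hP : p • P = 0)
    {q : ℕ} (hnsq : ¬ IsSquare ((((-1 : ℤ) ^ (q / 2) * q : ℤ)) : ZMod p))
    (Vχ : WeierstrassCurve ℚ) [Vχ.IsElliptic] [Vχ.IsGloballyMinimal] (v : VariableChange ℚ)
    (hv : v • W.quadraticTwist (((-1 : ℤ) ^ (q / 2) * q : ℤ) : ℚ) = Vχ) :
    ∀ Q : (Vχ.baseChange ℚ_[p]).toAffine.Point, p • Q = 0 → Q = 0 :=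
  fun _ hQ ↦ eq_zero_of_prime_nsmul_eq_zero_of_unitTwist hp57 W hadd hP0 hP hnsq Vχ v hv hQ

end Twist

end Summit.BirchSwinnertonDyer.BirchSwinnertonDyer.Theorems.UnitTwistTorsion

end
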